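import Summits.AtomisticToContinuum.Crystallization.Theorems.ExcessDecayLiouvilleSiteGeometry

/-!
# Route `ExcessDecayLiouville`: discrete second-order Taylor estimates

Step (c4) (`DiscreteTaylor`) of the energy route for item `ExcessDecay` (stmt-AtomisticToContinuum-9334), abstract
part, in a seminormed additive group `F`:

* `sub_sub_smul_eq_sum_sum` : the identity `g m − g 0 − m • (g 1 − g 0) = Σ_{i<m} Σ_{l<i} D²g l` on `ℕ`, with
  `D²g l = g (l+2) − g (l+1) − (g (l+1) − g l)`;
* `norm_taylor_nat_le` : hence `‖g m − g 0 − m • (g 1 − g 0)‖ ≤ m² · S` if `0 ≤ S` and `‖D²g l‖ ≤ S` for `l + 2 ≤ m`;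
* `norm_taylor_int_le` : the two-sided version on `ℤ`, `‖g m − g 0 − m • (g 1 − g 0)‖ ≤ 2 m² · S` if `‖D²g l‖ ≤ S`
  for all `l` with `|l| ≤ |m|`, obtained from the `ℕ` version applied to `g` and to the reversed sequence plus one
  correction term `|m| • D²g (−1)`.

The three-dimensional statement along lattice paths is assembled from these in the `InteriorDecay` step.
All `[folklore]`; helper lemmas, nothing here closes an item.
-/

noncomputable section

namespace Summit.AtomisticToContinuum.Crystallization.Theorems.ExcessDecayLiouville

open scoped BigOperators

section Taylor

variable {F : Type*} [SeminormedAddCommGroup F]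

/-- Telescoping on `ℕ`: `g m − g 0 = Σ_{i<m} (g (i+1) − g i)`. [folklore] -/
theorem sub_eq_sum_diff (g : ℕ → F) (m : ℕ) : g m - g 0 = ∑ i ∈ Finset.range m, (g (i + 1) - g i) := by
  induction m with
  | zero => simp
  | succ k ih => rw [Finset.sum_range_succ, ← ih]; abel

/-- **Discrete Taylor identity on `ℕ`**: `g m − g 0 − m • (g 1 − g 0) = Σ_{i<m} Σ_{l<i} D²g l`. [folklore] -/
theorem sub_sub_smul_eq_sum_sum (g : ℕ → F) (m : ℕ) :
    g m - g 0 - m • (g 1 - g 0) =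
      ∑ i ∈ Finset.range m, ∑ l ∈ Finset.range i, ((g (l + 2) - g (l + 1)) - (g (l + 1) - g l)) := by
  have hinner : ∀ i : ℕ, ∑ l ∈ Finset.range i, ((g (l + 2) - g (l + 1)) - (g (l + 1) - g l)) =
      (g (i + 1) - g i) - (g 1 - g 0) := by
    intro i
    have := sub_eq_sum_diff (fun l => g (l + 1) - g l) i
    simp only [zero_add] at this
    rw [this]
  simp_rw [hinner]
  rw [Finset.sum_sub_distrib, ← sub_eq_sum_diff g m, Finset.sum_const, Finset.card_range]

/-- **Discrete Taylor bound on `ℕ`**: if `0 ≤ S` and `‖D²g l‖ ≤ S` for all `l` with `l + 2 ≤ m`, then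
`‖g m − g 0 − m • (g 1 − g 0)‖ ≤ m² · S`. [folklore] -/
theorem norm_taylor_nat_le (g : ℕ → F) {m : ℕ} {S : ℝ} (hS0 : 0 ≤ S)
    (hS : ∀ l : ℕ, l + 2 ≤ m → ‖(g (l + 2) - g (l + 1)) - (g (l + 1) - g l)‖ ≤ S) :
    ‖g m - g 0 - m • (g 1 - g 0)‖ ≤ (m : ℝ) ^ 2 * S := by
  rw [sub_sub_smul_eq_sum_sum]
  refine (norm_sum_le _ _).trans ?_
  have hrow : ∀ i ∈ Finset.range m,
      ‖∑ l ∈ Finset.range i, ((g (l + 2) - g (l + 1)) - (g (l + 1) - g l))‖ ≤ (i : ℝ) * S := by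
    intro i hi
    have hi' : i < m := Finset.mem_range.1 hi
    refine (norm_sum_le _ _).trans ?_
    have : ∑ l ∈ Finset.range i, ‖(g (l + 2) - g (l + 1)) - (g (l + 1) - g l)‖ ≤ ∑ _l ∈ Finset.range i, S :=
      Finset.sum_le_sum fun l hl => hS l (by have := Finset.mem_range.1 hl; omega)
    simpa [Finset.sum_const, Finset.card_range] using this
  refine (Finset.sum_le_sum hrow).trans ?_
  rw [← Finset.sum_mul]
  refine mul_le_mul_of_nonneg_right ?_ hS0
  have : ∑ i ∈ Finset.range m, (i : ℝ) ≤ ∑ _i ∈ Finset.range m, (m : ℝ) :=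
    Finset.sum_le_sum fun i hi => by exact_mod_cast (Finset.mem_range.1 hi).le
  refine this.trans ?_
  simp only [Finset.sum_const, Finset.card_range, nsmul_eq_mul]
  nlinarith

/-- **Discrete Taylor bound on `ℤ`** (two-sided): if `0 ≤ S` and `‖D²g l‖ ≤ S` for all `l : ℤ` with `|l| ≤ |m|`, then
`‖g m − g 0 − m • (g 1 − g 0)‖ ≤ 2 m² · S`. [folklore] -/
theorem norm_taylor_int_le (g : ℤ → F) {m : ℤ} {S : ℝ} (hS0 : 0 ≤ S)
    (hS : ∀ l : ℤ, |l| ≤ |m| → ‖(g (l + 2) - g (l + 1)) - (g (l + 1) - g l)‖ ≤ S) :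
    ‖g m - g 0 - m • (g 1 - g 0)‖ ≤ 2 * (m : ℝ) ^ 2 * S := by
  rcases le_or_gt 0 m with hm | hm
  · -- nonnegative m = k: the ℕ statement for n ↦ g n
    obtain ⟨k, rfl⟩ := Int.eq_ofNat_of_zero_le hm
    have hS' : ∀ l : ℕ, l + 2 ≤ k →
        ‖(g ((l + 2 : ℕ) : ℤ) - g ((l + 1 : ℕ) : ℤ)) - (g ((l + 1 : ℕ) : ℤ) - g (l : ℤ))‖ ≤ S := by
      intro l hl
      have h1 := hS l (by rw [Nat.abs_cast, Nat.abs_cast]; exact_mod_cast (by omega : l ≤ k))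
      have a1 : ((l : ℤ) + 2) = ((l + 2 : ℕ) : ℤ) := by push_cast; ring
      have a2 : ((l : ℤ) + 1) = ((l + 1 : ℕ) : ℤ) := by push_cast; ring
      rw [a1, a2] at h1
      exact h1
    have h := norm_taylor_nat_le (fun n : ℕ => g n) hS0 hS'
    simp only [Nat.cast_zero, Nat.cast_one] at h
    rw [← natCast_zsmul] at h
    refine h.trans ?_
    have : ((k : ℤ) : ℝ) = (k : ℝ) := by simp
    rw [this]
    nlinarith [sq_nonneg (k : ℝ)]
  · -- negative m = −k: the ℕ statement for the reversed sequence n ↦ g (−n), plus one correction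
    obtain ⟨k, rfl⟩ := Int.exists_eq_neg_ofNat hm.le
    have hk0 : 0 < k := by omega
    have hS' : ∀ l : ℕ, l + 2 ≤ k →
        ‖(g (-((l + 2 : ℕ) : ℤ)) - g (-((l + 1 : ℕ) : ℤ))) - (g (-((l + 1 : ℕ) : ℤ)) - g (-(l : ℤ)))‖ ≤ S := by
      intro l hl
      have h1 := hS (-((l + 2 : ℕ) : ℤ)) (by
        rw [abs_neg, abs_neg, Nat.abs_cast, Nat.abs_cast]; exact_mod_cast hl)
      have a1 : (-((l + 2 : ℕ) : ℤ) + 2) = -(l : ℤ) := by push_cast; ring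
      have a2 : (-((l + 2 : ℕ) : ℤ) + 1) = -((l + 1 : ℕ) : ℤ) := by push_cast; ring
      rw [a1, a2] at h1
      have e : (g (-(l : ℤ)) - g (-((l + 1 : ℕ) : ℤ))) - (g (-((l + 1 : ℕ) : ℤ)) - g (-((l + 2 : ℕ) : ℤ))) =
          (g (-((l + 2 : ℕ) : ℤ)) - g (-((l + 1 : ℕ) : ℤ))) - (g (-((l + 1 : ℕ) : ℤ)) - g (-(l : ℤ))) := by abel
      rw [e] at h1
      exact h1
    have h := norm_taylor_nat_le (fun n : ℕ => g (-(n : ℤ))) hS0 hS'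
    simp only [Nat.cast_zero, neg_zero, Nat.cast_one] at h
    rw [← natCast_zsmul] at h
    -- h : ‖g (-↑k) - g 0 - (k:ℤ) • (g (-1) - g 0)‖ ≤ ↑k ^ 2 * S
    have hcorr : ‖(g 1 - g 0) - (g 0 - g (-1))‖ ≤ S := by
      have h1 := hS (-1) (by rw [abs_neg, abs_one, abs_neg, Nat.abs_cast]; exact_mod_cast hk0)
      have a1 : (-1 + 2 : ℤ) = 1 := by norm_num
      have a2 : (-1 + 1 : ℤ) = 0 := by norm_num
      rw [a1, a2] at h1
      exact h1
    have hXY : g (-(k : ℤ)) - g 0 - (-(k : ℤ)) • (g 1 - g 0) =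
        (g (-(k : ℤ)) - g 0 - (k : ℤ) • (g (-1) - g 0)) + (k : ℤ) • ((g 1 - g 0) - (g 0 - g (-1))) := by
      module
    rw [hXY]
    refine (norm_add_le _ _).trans ?_
    have hz : ‖(k : ℤ) • ((g 1 - g 0) - (g 0 - g (-1)))‖ ≤ k * S := by
      refine (norm_zsmul_le _ _).trans ?_
      rw [Int.norm_natCast]
      exact mul_le_mul_of_nonneg_left hcorr (by positivity)
    have hcast : ((-(k : ℤ) : ℤ) : ℝ) ^ 2 = (k : ℝ) ^ 2 := by push_cast; ring
    rw [hcast]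
    have hk1 : (1 : ℝ) ≤ k := by exact_mod_cast hk0
    have hkS : (k : ℝ) * S ≤ (k : ℝ) ^ 2 * S := by
      have : (k : ℝ) ≤ (k : ℝ) ^ 2 := by nlinarith
      exact mul_le_mul_of_nonneg_right this hS0
    linarith [hz, h, hkS]

end Taylor

end Summit.AtomisticToContinuum.Crystallization.Theorems.ExcessDecayLiouville

end
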